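import Literature.NumberTheory.LFunctions.WeilMarkovQuadratic
import Literature.NumberTheory.LFunctions.WeilWindowSuzukiProofs
import Literature.NumberTheory.LFunctions.WeilWindowSuzukiAsymptoticProofs
import Summits.RiemannHypothesis.RiemannHypothesis.Theorems.WeilWindowFlowWindowLipschitzStubCommutatorBoundAux
import Mathlib.MeasureTheory.Function.L2Space
import Mathlib.Analysis.SpecialFunctions.Integrability.Basic
import Mathlib.Analysis.Complex.ExponentialBounds

/-!
# Auxiliary lemmas for stub `stub_barrierWeakForm`
(line `borderline-barrier`, crux `WeilWindowFlow.WindowLipschitz`)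

Elementary facts about the explicit two-scale barrier
`B(x) = (log(1/min(a − |x|, d₀)))^{-1/2}` on the window `(-a, a)` (`0` outside) and the
archimedean density `ρ = weilArchDensity`, used in the weak (Fubini) form of the surplus:

* a Lipschitz bound for the profile `W(s) = (log 1/s)^{-1/2}` on `[σ, 1/2]`
  (`|W s₁ − W s₂| ≤ 4|s₁ − s₂|/σ`, from `log(s₂/s₁) ≤ (s₂ − s₁)/s₁` and `√(log 2) ≥ 1/2`);
* measurability of `B`, the bounds `0 ≤ B ≤ β₀ = W(d₀)`, and the local Lipschitz bound
  `|B z − B x| ≤ 8 s/(a − |x|)` for `|z − x| ≤ s ≤ (a − |x|)/2` at a layer point `x`;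
* the tail bound `∫_{Ioi δ} ρ ≤ log(1/δ) + ∫_{Ioi 1} ρ` (`ρ ≤ 1/t` on `(0, 1]`);
* the conversion `8 + 2β(log(2/d) + I) ≤ (8 + β(10 + 2I)) d^{-1/4}`;
* integrability of `(a − |x|)^{-1/2}` on the layer `a − d₀ < |x| < a`;
* the per-`t` identity `∫ (B(x+t) − B x)(w(x+t) − w x) dx = ∫ w(x)(2B x − B(x+t) − B(x−t)) dx`
  (translation invariance of Lebesgue measure).

Everything is folklore real analysis over Mathlib.

## References

* H. Chen, T. Weth, *The Dirichlet problem for the logarithmic Laplacian*, Comm. PDE 44 (2019),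
  arXiv:1710.03416, §3.
-/

set_option linter.dupNamespace false

noncomputable section

open MeasureTheory Set Filter
open scoped Topology ENNReal NNReal

namespace Summit.RiemannHypothesis.RiemannHypothesis.Theorems.WeilWindowFlowWindowLipschitz

open Literature.NumberTheory.LFunctions

/-! ## The profile `W(s) = (log 1/s)^{-1/2}`: a Lipschitz bound on `[σ, 1/2]` -/

/-- One-sided Lipschitz bound for `W(s) = (log 1/s)^{-1/2}` on `[σ, 1/2]`:
`0 ≤ W s₂ − W s₁ ≤ 4 (s₂ − s₁)/σ` for `σ ≤ s₁ ≤ s₂ ≤ 1/2` (`log(s₂/s₁) ≤ (s₂ − s₁)/s₁` and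
`√(log 2) ≥ 1/2`). [folklore] -/
theorem stub_barrierWeakForm_W_sub_le {σ s₁ s₂ : ℝ} (hσ : 0 < σ) (h1 : σ ≤ s₁)
    (h12 : s₁ ≤ s₂) (h2 : s₂ ≤ 1 / 2) :
    0 ≤ 1 / Real.sqrt (Real.log (1 / s₂)) - 1 / Real.sqrt (Real.log (1 / s₁)) ∧
      1 / Real.sqrt (Real.log (1 / s₂)) - 1 / Real.sqrt (Real.log (1 / s₁)) ≤
        4 * (s₂ - s₁) / σ := by
  have hs₁ : 0 < s₁ := hσ.trans_le h1
  have hs₂ : 0 < s₂ := hs₁.trans_le h12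
  have hL₂ : Real.log 2 ≤ Real.log (1 / s₂) := by
    refine Real.log_le_log two_pos ?_
    rw [le_div_iff₀ hs₂]
    linarith
  have hL₁₂ : Real.log (1 / s₂) ≤ Real.log (1 / s₁) :=
    Real.log_le_log (by positivity) (one_div_le_one_div_of_le hs₁ h12)
  have hlog2 : (1 / 4 : ℝ) ≤ Real.log 2 := by linarith [Real.log_two_gt_d9]
  set u₁ := Real.sqrt (Real.log (1 / s₁)) with hu₁_def
  set u₂ := Real.sqrt (Real.log (1 / s₂)) with hu₂_def
  have hu₂ : 1 / 2 ≤ u₂ := by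
    have e : (1 / 2 : ℝ) = Real.sqrt (1 / 4) := by
      rw [show (1 / 4 : ℝ) = (1 / 2) ^ 2 by norm_num, Real.sqrt_sq (by norm_num)]
    rw [e]
    exact Real.sqrt_le_sqrt (hlog2.trans hL₂)
  have hu₁₂ : u₂ ≤ u₁ := Real.sqrt_le_sqrt hL₁₂
  have hu₂pos : 0 < u₂ := by linarith
  have hu₁pos : 0 < u₁ := by linarith
  have hdiff : Real.log (1 / s₁) - Real.log (1 / s₂) ≤ (s₂ - s₁) / σ := by
    have e : Real.log (1 / s₁) - Real.log (1 / s₂) = Real.log (s₂ / s₁) := by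
      rw [one_div, one_div, Real.log_inv, Real.log_inv, Real.log_div hs₂.ne' hs₁.ne']
      ring
    rw [e]
    calc Real.log (s₂ / s₁) ≤ s₂ / s₁ - 1 := Real.log_le_sub_one_of_pos (by positivity)
      _ = (s₂ - s₁) / s₁ := by field_simp
      _ ≤ (s₂ - s₁) / σ := div_le_div_of_nonneg_left (by linarith) hσ h1
  have hsq : u₁ ^ 2 - u₂ ^ 2 = Real.log (1 / s₁) - Real.log (1 / s₂) := by
    rw [hu₁_def, hu₂_def, Real.sq_sqrt (by linarith), Real.sq_sqrt (by linarith)]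
  have hP : (u₁ - u₂) * (u₁ + u₂) * σ ≤ s₂ - s₁ := by
    have h3 : (u₁ ^ 2 - u₂ ^ 2) * σ ≤ s₂ - s₁ := by
      rw [hsq, ← le_div_iff₀ hσ]
      exact hdiff
    nlinarith [h3]
  have hBig : 1 ≤ 4 * ((u₁ + u₂) * (u₂ * u₁)) := by
    have hA : 1 / 4 ≤ u₂ * u₁ := by nlinarith
    nlinarith
  refine ⟨?_, ?_⟩
  · rw [sub_nonneg]
    exact one_div_le_one_div_of_le hu₂pos hu₁₂
  · rw [div_sub_div _ _ hu₂pos.ne' hu₁pos.ne', one_mul, mul_one,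
      div_le_div_iff₀ (mul_pos hu₂pos hu₁pos) hσ]
    have hnn : 0 ≤ (u₁ - u₂) * σ := mul_nonneg (sub_nonneg.2 hu₁₂) hσ.le
    calc (u₁ - u₂) * σ ≤ (u₁ - u₂) * σ * (4 * ((u₁ + u₂) * (u₂ * u₁))) :=
          le_mul_of_one_le_right hnn hBig
      _ = 4 * ((u₁ - u₂) * (u₁ + u₂) * σ) * (u₂ * u₁) := by ring
      _ ≤ 4 * (s₂ - s₁) * (u₂ * u₁) := by gcongr

/-- Lipschitz bound for `W(s) = (log 1/s)^{-1/2}` on `[σ, 1/2]`: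
`|W s₁ − W s₂| ≤ 4 |s₁ − s₂| / σ`. [folklore] -/
theorem stub_barrierWeakForm_W_lipschitz {σ s₁ s₂ : ℝ} (hσ : 0 < σ) (h1 : σ ≤ s₁)
    (h1' : s₁ ≤ 1 / 2) (h2 : σ ≤ s₂) (h2' : s₂ ≤ 1 / 2) :
    |1 / Real.sqrt (Real.log (1 / s₁)) - 1 / Real.sqrt (Real.log (1 / s₂))| ≤
      4 * |s₁ - s₂| / σ := by
  rcases le_total s₁ s₂ with h | h
  · obtain ⟨h0, hle⟩ := stub_barrierWeakForm_W_sub_le hσ h1 h h2'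
    rw [abs_sub_comm, abs_of_nonneg h0, abs_sub_comm, abs_of_nonneg (sub_nonneg.2 h)]
    exact hle
  · obtain ⟨h0, hle⟩ := stub_barrierWeakForm_W_sub_le hσ h2 h h1'
    rw [abs_of_nonneg h0, abs_of_nonneg (sub_nonneg.2 h)]
    exact hle

/-! ## The barrier: measurability, bounds, local Lipschitz bound -/

/-- The explicit barrier is measurable. [folklore] -/
theorem stub_barrierWeakForm_B_measurable {a d₀ : ℝ} {B : ℝ → ℝ}
    (hB : ∀ x, B x = if |x| < a then 1 / Real.sqrt (Real.log (1 / min (a - |x|) d₀)) else 0) :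
    Measurable B := by
  have e : B = fun x ↦ if |x| < a then 1 / Real.sqrt (Real.log (1 / min (a - |x|) d₀)) else 0 :=
    funext hB
  rw [e]
  refine Measurable.ite (measurableSet_lt continuous_abs.measurable measurable_const) ?_
    measurable_const
  exact measurable_const.div ((((measurable_const.sub continuous_abs.measurable).min
    measurable_const).const_div 1).log.sqrt)

/-- The barrier takes values in `[0, β₀]`, `β₀ = (log 1/d₀)^{-1/2}` (`min ≤ d₀`, `2 d₀ ≤ 1`).
[folklore] -/
theorem stub_barrierWeakForm_B_bounds {a d₀ : ℝ} {B : ℝ → ℝ} (hd₀ : 0 < d₀)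
    (h2d₀ : 2 * d₀ ≤ 1)
    (hB : ∀ x, B x = if |x| < a then 1 / Real.sqrt (Real.log (1 / min (a - |x|) d₀)) else 0)
    (x : ℝ) : 0 ≤ B x ∧ B x ≤ 1 / Real.sqrt (Real.log (1 / d₀)) := by
  rw [hB x]
  split_ifs with hx
  · have hm : 0 < min (a - |x|) d₀ := lt_min (by linarith) hd₀
    have hm' : min (a - |x|) d₀ ≤ d₀ := min_le_right _ _
    have hlog : Real.log (1 / d₀) ≤ Real.log (1 / min (a - |x|) d₀) :=
      Real.log_le_log (by positivity) (one_div_le_one_div_of_le hm hm')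
    have h1 : 1 < 1 / d₀ := by
      rw [lt_div_iff₀ hd₀]
      linarith
    have hpos : 0 < Real.log (1 / d₀) := Real.log_pos h1
    exact ⟨by positivity,
      one_div_le_one_div_of_le (Real.sqrt_pos.2 hpos) (Real.sqrt_le_sqrt hlog)⟩
  · exact ⟨le_rfl, by positivity⟩

/-- `|2B x − B(x+t) − B(x−t)| ≤ 2β₀`. [folklore] -/
theorem stub_barrierWeakForm_K_bound {a d₀ : ℝ} {B : ℝ → ℝ} (hd₀ : 0 < d₀)
    (h2d₀ : 2 * d₀ ≤ 1)
    (hB : ∀ x, B x = if |x| < a then 1 / Real.sqrt (Real.log (1 / min (a - |x|) d₀)) else 0)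
    (x t : ℝ) :
    |2 * B x - B (x + t) - B (x - t)| ≤ 2 * (1 / Real.sqrt (Real.log (1 / d₀))) := by
  have h0 := stub_barrierWeakForm_B_bounds hd₀ h2d₀ hB x
  have h1 := stub_barrierWeakForm_B_bounds hd₀ h2d₀ hB (x + t)
  have h2 := stub_barrierWeakForm_B_bounds hd₀ h2d₀ hB (x - t)
  rw [abs_le]
  constructor <;> linarith [h0.1, h0.2, h1.1, h1.2, h2.1, h2.2]

/-- **Local Lipschitz bound of the barrier.** At a layer point `x` (depth `d = a − |x| ∈ (0, d₀)`),
`|B z − B x| ≤ 8 s / d` whenever `|z − x| ≤ s ≤ d/2` (both frozen depths lie in `[d/2, 1/2]`,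
where `W` is `4/(d/2)`-Lipschitz). [folklore] -/
theorem stub_barrierWeakForm_B_lip {a d₀ : ℝ} {B : ℝ → ℝ} (h2d₀ : 2 * d₀ ≤ 1)
    (hB : ∀ x, B x = if |x| < a then 1 / Real.sqrt (Real.log (1 / min (a - |x|) d₀)) else 0)
    {x z s : ℝ} (hx1 : a - d₀ < |x|) (hx2 : |x| < a) (hz : |z - x| ≤ s)
    (hs : s ≤ (a - |x|) / 2) :
    |B z - B x| ≤ 8 * s / (a - |x|) := by
  have hd : 0 < a - |x| := by linarith
  have hs0 : 0 ≤ s := (abs_nonneg _).trans hz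
  have habs : |z| - |x| ≤ |z - x| := abs_sub_abs_le_abs_sub z x
  have hzd : (a - |x|) / 2 ≤ a - |z| := by linarith
  have hza : |z| < a := by linarith
  rw [hB z, hB x, if_pos hza, if_pos hx2]
  have key := stub_barrierWeakForm_W_lipschitz (σ := (a - |x|) / 2) (s₁ := min (a - |z|) d₀)
    (s₂ := min (a - |x|) d₀) (by positivity) (le_min hzd (by linarith))
    ((min_le_right _ _).trans (by linarith)) (le_min (by linarith) (by linarith))
    ((min_le_right _ _).trans (by linarith))
  have hmin : |min (a - |z|) d₀ - min (a - |x|) d₀| ≤ s := by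
    refine (abs_min_sub_min_le_max _ _ _ _).trans
      (max_le ?_ (by rw [sub_self, abs_zero]; exact hs0))
    rw [show a - |z| - (a - |x|) = |x| - |z| by ring]
    exact (abs_abs_sub_abs_le_abs_sub x z).trans (by rwa [abs_sub_comm])
  calc |1 / Real.sqrt (Real.log (1 / min (a - |z|) d₀)) -
        1 / Real.sqrt (Real.log (1 / min (a - |x|) d₀))|
      ≤ 4 * |min (a - |z|) d₀ - min (a - |x|) d₀| / ((a - |x|) / 2) := key
    _ = 8 * |min (a - |z|) d₀ - min (a - |x|) d₀| / (a - |x|) := by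
        field_simp
        ring
    _ ≤ 8 * s / (a - |x|) := by gcongr

/-! ## The archimedean density: tail integral -/

/-- `∫_{Ioi δ} ρ ≤ log(1/δ) + ∫_{Ioi 1} ρ` for `0 < δ ≤ 1` (`ρ(t) ≤ 1/t` on `(0, 1]`).
[folklore] -/
theorem stub_barrierWeakForm_rho_tail : ∀ {δ : ℝ}, 0 < δ → δ ≤ 1 → ∫ t in Ioi δ, weilArchDensity t ≤ Real.log (1 / δ) + ∫ t in Ioi 1, weilArchDensity t := by
  intro δ hδ hδ1
  have hI : IntegrableOn weilArchDensity (Ioi δ) := integrableOn_weilArchDensity_Ioi hδ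
  rw [← Ioc_union_Ioi_eq_Ioi hδ1, setIntegral_union Ioc_disjoint_Ioi_same measurableSet_Ioi
    (hI.mono_set Ioc_subset_Ioi_self) (hI.mono_set (Ioi_subset_Ioi hδ1))]
  gcongr
  have hinv : IntegrableOn (fun t : ℝ ↦ t⁻¹) (Ioc δ 1) := by
    have hc : ContinuousOn (fun t : ℝ ↦ t⁻¹) (Icc δ 1) :=
      continuousOn_id.inv₀ fun t ht ↦ (hδ.trans_le ht.1).ne'
    exact hc.integrableOn_Icc.mono_set Ioc_subset_Icc_self
  calc ∫ t in Ioc δ 1, weilArchDensity t ≤ ∫ t in Ioc δ 1, t⁻¹ := by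
        refine setIntegral_mono_on (hI.mono_set Ioc_subset_Ioi_self) hinv measurableSet_Ioc
          fun t ht ↦ ?_
        rw [← one_div]
        exact stub_commutatorBound_rho_le_inv (hδ.trans ht.1) ht.2
    _ = Real.log (1 / δ) := by
        rw [← intervalIntegral.integral_of_le hδ1, integral_inv_of_pos hδ one_pos]

/-- Conversion of the logarithmic bound into a power bound: for `0 < d ≤ 1`, `0 ≤ β`, `0 ≤ I`,
`8 + 2β (log(2/d) + I) ≤ (8 + β (10 + 2 I)) d^{-1/4}` (`log 2 ≤ 1`, `log(1/d) ≤ 4 d^{-1/4}`).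
[folklore] -/
theorem stub_barrierWeakForm_log_le_rpow {d β I : ℝ} (hd : 0 < d) (hd1 : d ≤ 1) (hβ : 0 ≤ β)
    (hI : 0 ≤ I) :
    8 + 2 * β * (Real.log (2 / d) + I) ≤ (8 + β * (10 + 2 * I)) * d ^ (-(1 / 4) : ℝ) := by
  set r := d ^ (-(1 / 4) : ℝ) with hr
  have hr1 : 1 ≤ r := Real.one_le_rpow_of_pos_of_le_one_of_nonpos hd hd1 (by norm_num)
  have hlog : Real.log (2 / d) ≤ 1 + 4 * r := by
    rw [Real.log_div two_ne_zero hd.ne']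
    have h2 : Real.log 2 ≤ 1 := by linarith [Real.log_two_lt_d9]
    have h3 : -Real.log d ≤ 4 * r := by
      rw [← Real.log_inv]
      have h := Real.log_le_rpow_div (inv_nonneg.2 hd.le) (by norm_num : (0 : ℝ) < 1 / 4)
      rw [Real.inv_rpow hd.le, ← Real.rpow_neg hd.le] at h
      have e : d ^ (-(1 / 4) : ℝ) / (1 / 4) = 4 * r := by
        rw [hr]
        ring
      linarith [h, e]
    linarith
  have h4 : 2 * β * (Real.log (2 / d) + I) ≤ 2 * β * (1 + 4 * r + I) :=
    mul_le_mul_of_nonneg_left (by linarith) (by positivity)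
  nlinarith [mul_nonneg hβ (sub_nonneg.2 hr1), mul_nonneg (mul_nonneg hβ hI) (sub_nonneg.2 hr1)]

/-! ## Integrability of `(a − |x|)^{-1/2}` on the layer -/

/-- `x ↦ (a − |x|)^{-1/2}` is integrable on the layer `a − d₀ < |x| < a` (two translates of
`s ↦ s^{-1/2}` on `(0, d₀)`). [folklore] -/
theorem stub_barrierWeakForm_integrableOn_layer {a d₀ : ℝ} (hd₀ : 0 < d₀) (hd₀a : d₀ < a) :
    IntegrableOn (fun x ↦ (a - |x|) ^ (-(1 / 2) : ℝ)) {x | a - d₀ < |x| ∧ |x| < a} := by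
  have h0 : IntervalIntegrable (fun x : ℝ ↦ x ^ (-(1 / 2) : ℝ)) volume 0 d₀ :=
    intervalIntegral.intervalIntegrable_rpow' (by norm_num)
  have hpos : IntegrableOn (fun x ↦ (a - |x|) ^ (-(1 / 2) : ℝ)) (Ioo (a - d₀) a) := by
    have h := h0.comp_sub_left a
    rw [sub_zero, intervalIntegrable_iff, uIoc_of_ge (by linarith)] at h
    refine (h.mono_set Ioo_subset_Ioc_self).congr_fun (fun x hx ↦ ?_) measurableSet_Ioo
    have hx0 : 0 ≤ x := by linarith [hx.1]
    simp only [abs_of_nonneg hx0]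
  have hneg : IntegrableOn (fun x ↦ (a - |x|) ^ (-(1 / 2) : ℝ)) (Ioo (-a) (d₀ - a)) := by
    have h := h0.comp_add_right a
    rw [zero_sub, intervalIntegrable_iff, uIoc_of_le (by linarith)] at h
    refine (h.mono_set Ioo_subset_Ioc_self).congr_fun (fun x hx ↦ ?_) measurableSet_Ioo
    have hx0 : x ≤ 0 := by linarith [hx.2]
    simp only [abs_of_nonpos hx0, sub_neg_eq_add, add_comm a x]
  refine (hpos.union hneg).mono_set fun x hx ↦ ?_
  obtain ⟨hx1, hx2⟩ : a - d₀ < |x| ∧ |x| < a := hx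
  rcases le_total 0 x with h | h
  · left
    rw [abs_of_nonneg h] at hx1 hx2
    exact ⟨hx1, hx2⟩
  · right
    rw [abs_of_nonpos h] at hx1 hx2
    exact ⟨by linarith, by linarith⟩

/-! ## The per-`t` identity -/

/-- **Translation invariance**: for bounded measurable `B` and integrable `w`,
`∫ (B(x+t) − B x)(w(x+t) − w x) dx = ∫ w(x) (2B x − B(x+t) − B(x−t)) dx`. [folklore] -/
theorem stub_barrierWeakForm_perT {B w : ℝ → ℝ} {β : ℝ} (hBm : Measurable B)
    (hBb : ∀ x, |B x| ≤ β) (hw : Integrable w) (t : ℝ) :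
    ∫ x, (B (x + t) - B x) * (w (x + t) - w x) =
      ∫ x, w x * (2 * B x - B (x + t) - B (x - t)) := by
  have i1 : Integrable (fun x ↦ (B x - B (x - t)) * w x) := by
    refine hw.bdd_mul (c := β + β)
      (hBm.sub (hBm.comp (measurable_id.sub_const t))).aestronglyMeasurable
      (ae_of_all _ fun x ↦ ?_)
    rw [Real.norm_eq_abs]
    exact (abs_sub _ _).trans (add_le_add (hBb _) (hBb _))
  have i2 : Integrable (fun x ↦ (B (x + t) - B x) * w x) := by
    refine hw.bdd_mul (c := β + β)
      ((hBm.comp (measurable_id.add_const t)).sub hBm).aestronglyMeasurable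
      (ae_of_all _ fun x ↦ ?_)
    rw [Real.norm_eq_abs]
    exact (abs_sub _ _).trans (add_le_add (hBb _) (hBb _))
  have i3 : Integrable (fun x ↦ (B (x + t) - B x) * w (x + t)) := by
    have h := i1.comp_add_right t
    simpa only [add_sub_cancel_right] using h
  have e1 : ∫ x, (B (x + t) - B x) * w (x + t) = ∫ x, (B x - B (x - t)) * w x := by
    have h := integral_add_right_eq_self (μ := volume) (fun x ↦ (B x - B (x - t)) * w x) t
    simpa only [add_sub_cancel_right] using h
  have e : (fun x ↦ (B (x + t) - B x) * (w (x + t) - w x)) =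
      fun x ↦ (B (x + t) - B x) * w (x + t) - (B (x + t) - B x) * w x := by
    funext x
    ring
  rw [e, integral_sub i3 i2, e1, ← integral_sub i1 i2]
  congr 1
  funext x
  ring

end Summit.RiemannHypothesis.RiemannHypothesis.Theorems.WeilWindowFlowWindowLipschitz

end
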